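import Literature.NumberTheory.LFunctions.XiDerivativeZerosCounting
import Literature.NumberTheory.LFunctions.CriticalLineTwoThirdsTheoremAProofs
import Literature.NumberTheory.LFunctions.RiemannXiProofs
import Literature.NumberTheory.LFunctions.HardyZSignParity
import HarnessLib

/-!
# Critical zeros of `ξ′` from critical zeros of `ζ` by Rolle's theorem: `N₀ˢ(T) ≤ N^{(1)}₀(T) + 1`,
# hence unconditionally `N^{(1)}₀(T) ≥ (2/3 − ε) N(T)`

RH-FREE (every statement below is an unconditional theorem of this tree; «nothing here bears on the
truth of RH»). Topic `Literature/NumberTheory/LFunctions`, namespace `Literature.NumberTheory.LFunctions`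
(helpers in `XiDerivRolle`). PROOF LAYER for `XiDerivativeZeros.lean` (Conrey 1983, J. Number Theory 16,
the counting functions `N^{(1)}₀(T) = xiDerivCriticalZeroCount 1 T` of the zeros of `ξ′` on the critical
line): theorems only — no definitions, no named facts.

What is proved (all `T`, no hypothesis):

* `XiDerivRolle.ncard_criticalZeros_le` — the number of DISTINCT zeros of `ζ` on the critical segment
  `Re s = ½`, `0 < Im s ≤ T` is at most `N^{(1)}₀(T) + 1`: between two consecutive ordinates of zeros of
  `ξ(½ + it) = Ξ(t)` (a real function of `t`, `im_riemannXi_critical`) Rolle's theorem puts a zero of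
  `ξ′` on the line (the tree's `XiDerivCount.exists_deriv_riemannXi_eq_zero_between`), and `k` distinct
  ordinates give `k − 1` pairwise distinct such zeros, all with ordinate in `(0, T]`.
* `simpleCriticalZeroCount_le_xiDerivCriticalZeroCount_add_one` — in particular
  `N₀ˢ(T) ≤ N^{(1)}₀(T) + 1` (`N₀ˢ = simpleCriticalZeroCount`, simple zeros of `ζ` on the line are
  distinct points of that segment).
* `eventually_two_thirds_mul_zetaZeroCount_le_xiDerivCriticalZeroCount` — with [AF26] Theorem A (i) in
  its cumulative form, PROVED in the tree (`AlpogeFurman2026_simple_critical_holds`,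
  `CriticalLineTwoThirdsTheoremAProofs.lean`: `∀ ε > 0`, eventually `(2/3 − ε) N(T) ≤ N₀ˢ(T)`), for every
  `ε > 0` and all large `T`: **`(2/3 − ε) N(T) ≤ N^{(1)}₀(T)`** — unconditionally at least
  `(2/3 − ε) N(T)` zeros of `ξ′`, counted with multiplicity, lie ON the critical line below height `T`;
  `eventually_two_thirds_mul_main_le_xiDerivCriticalZeroCount` is the same with `(T/2π) log T` in place of
  `N(T)` (Riemann–von Mangoldt, `AlpogeFurman2026.eventually_zetaZeroCount_near_main`).

Status / what this is NOT. The print record for `ξ′` is Conrey's `κ′₁ ≥ 0.8137` (J. Number Theory 16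
(1983), Corollary p. 50, Levinson's method; the tree's named fact `conrey1983_xiDeriv_one`, NOT proved
here) and [AF26] Remark 7.1 claims `0.85838` (typed claim `AlpogeFurman2026_xiDeriv_simple_critical_dyadic`,
no printed proof). The bound here is a COUNT (`≥ (2/3 − ε) N(T)` critical zeros of `ξ′`), elementary
from Theorem A; turning it into the PROPORTION `κ′₁ ≥ 2/3` needs the zero-counting function of `ξ′`,
`N^{(1)}(T) = N(T) + O(log T)` (Conrey 1983, Lemma 2), which is the business of the sibling file
`XiDerivativeZeroCountingFunction.lean`. The Rolle step is the classical remark that the zeros of `Ξ′`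
interlace the real zeros of `Ξ` (Conrey 1983, §1; Levinson 1974). [AF26] = L. Alpöge, K. Furman,
arXiv:2608.13637v2 (2026), an unrefereed preprint whose Theorem A is a kernel theorem of this tree
(`AlpogeFurman2026_simple_critical_holds`, standard axioms); no endorsement of the preprint beyond that
kernel fact is implied. Nothing here bears on the truth of RH.

## References

* J. B. Conrey, *Zeros of derivatives of Riemann's ξ-function on the critical line*, J. Number Theory 16
  (1983) 49–74: §1 (p. 49: `N_m(T)`, `α_m`), Lemma 2 (p. 52). [key `Conrey1983`]
* L. Alpöge, K. Furman, *More than two thirds of the zeta zeros are simple and on the critical line*,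
  arXiv:2608.13637v2 (2026): Theorem A (i), Remark 7.1. [key `AlpogeFurman2026`]
* E. C. Titchmarsh, *The Theory of the Riemann Zeta-Function*, 2nd ed. (1986), §10.1 (`Ξ(t)` real for
  real `t`), Thm. 9.4 (Riemann–von Mangoldt). [key `Titchmarsh1986`]
-/

noncomputable section

open Complex Filter Set

namespace Literature.NumberTheory.LFunctions

namespace XiDerivRolle

/-- A zero of `ζ` on the critical segment is a zero of `t ↦ ξ(½ + it)` at its ordinate: `ρ = ½ + i·Im ρ`
and the zeros of `ξ` are the zeros of `ζ` in the open strip (`riemannXi_eq_zero_iff_holds`).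
[cite: Titchmarsh1986, §2.12] -/
theorem riemannXi_line_eq_zero_of_mem {T : ℝ} {ρ : ℂ}
    (hρ : ρ ∈ {ρ ∈ zetaZeroBox (1 / 2) T | ρ.re = 1 / 2}) :
    riemannXi (1 / 2 + (ρ.im : ℂ) * I) = 0 := by
  obtain ⟨⟨hζ, -, -, -, -⟩, hre⟩ := hρ
  have hρeq : (1 / 2 : ℂ) + (ρ.im : ℂ) * I = ρ := by
    apply Complex.ext <;> simp [hre]
  rw [hρeq]
  exact (riemannXi_eq_zero_iff_holds ρ).2 ⟨hζ, by rw [hre]; norm_num, by rw [hre]; norm_num⟩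

/-- On the critical segment the ordinate map `ρ ↦ Im ρ` is injective (`Re ρ = ½` is fixed).
[cite: Titchmarsh1986, §10.1] -/
theorem injOn_im_criticalZeros (T : ℝ) :
    InjOn Complex.im {ρ ∈ zetaZeroBox (1 / 2) T | ρ.re = 1 / 2} := by
  intro ρ hρ ρ' hρ' h
  exact Complex.ext (by rw [hρ.2, hρ'.2]) h

/-- **Rolle transfer, counted.** The number of distinct zeros of `ζ` on `Re s = ½`, `0 < Im s ≤ T` is at
most `N^{(1)}₀(T) + 1`: if `0 < t₀ < t₁ < ⋯ < t_{k−1} ≤ T` are their ordinates, Rolle's theorem for the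
real function `t ↦ ξ(½ + it)` (`XiDerivCount.exists_deriv_riemannXi_eq_zero_between`) gives zeros
`½ + ic_j` of `ξ′` with `t_j < c_j < t_{j+1}` (`j < k − 1`); these are `k − 1` pairwise distinct critical
zeros of `ξ′` with ordinates in `(0, T]`, so `k − 1 ≤ N^{(1)}₀(T)`
(`XiDerivCount.ncard_le_xiDerivCriticalZeroCount`). [cite: Conrey1983, §1 (p. 49)] -/
theorem ncard_criticalZeros_le (T : ℝ) :
    {ρ ∈ zetaZeroBox (1 / 2) T | ρ.re = 1 / 2}.ncard ≤ xiDerivCriticalZeroCount 1 T + 1 := by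
  classical
  set C : Set ℂ := {ρ ∈ zetaZeroBox (1 / 2) T | ρ.re = 1 / 2} with hC
  have hCfin : C.Finite := criticalZeroSet_finite T
  -- the finite set of ordinates, sorted increasingly
  set tF : Finset ℝ := hCfin.toFinset.image Complex.im with htF
  set k : ℕ := tF.card with hk
  have hcardC : C.ncard = k := by
    rw [hk, htF, Finset.card_image_of_injOn (by
      intro ρ hρ ρ' hρ' h
      exact injOn_im_criticalZeros T ((Set.Finite.mem_toFinset hCfin).1 hρ)
        ((Set.Finite.mem_toFinset hCfin).1 hρ') h), Set.ncard_eq_toFinset_card C hCfin]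
  rw [hcardC]
  -- every listed ordinate is the ordinate of a zero of `ξ` on the line, in `(0, T]`
  have hmem : ∀ u ∈ tF, riemannXi (1 / 2 + (u : ℂ) * I) = 0 ∧ 0 < u ∧ u ≤ T := by
    intro u hu
    rw [htF, Finset.mem_image] at hu
    obtain ⟨ρ, hρ, rfl⟩ := hu
    rw [Set.Finite.mem_toFinset] at hρ
    exact ⟨riemannXi_line_eq_zero_of_mem hρ, hρ.1.2.2.2.1, hρ.1.2.2.2.2⟩
  set t : Fin k ↪o ℝ := tF.orderEmbOfFin hk.symm with ht
  have htmem : ∀ j : Fin k, t j ∈ tF := fun j ↦ by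
    rw [ht]
    exact Finset.orderEmbOfFin_mem tF hk.symm j
  have htmono : StrictMono t := t.strictMono
  -- nothing to do when `k ≤ 1`
  rcases Nat.lt_or_ge k 2 with hk2 | hk2
  · omega
  -- Rolle between consecutive ordinates
  have hrolle : ∀ j : Fin (k - 1), ∃ c : ℝ,
      t ⟨j.1, by omega⟩ < c ∧ c < t ⟨j.1 + 1, by omega⟩ ∧ deriv riemannXi (1 / 2 + (c : ℂ) * I) = 0 := by
    intro j
    have hlt : t ⟨j.1, by omega⟩ < t ⟨j.1 + 1, by omega⟩ :=
      htmono (Fin.mk_lt_mk.2 (Nat.lt_succ_self _))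
    obtain ⟨c, hc, hc0⟩ := XiDerivCount.exists_deriv_riemannXi_eq_zero_between hlt
      (hmem _ (htmem _)).1 (hmem _ (htmem _)).1
    exact ⟨c, hc.1, hc.2, hc0⟩
  choose c hc_lo hc_hi hc_zero using hrolle
  -- the Rolle points increase strictly
  have hcmono : StrictMono c := by
    intro i j hij
    have hij' : i.1 < j.1 := hij
    calc c i < t ⟨i.1 + 1, by omega⟩ := hc_hi i
      _ ≤ t ⟨j.1, by omega⟩ := htmono.monotone (Fin.mk_le_mk.2 (by omega))
      _ < c j := hc_lo j
  -- the set of Rolle zeros of `ξ′`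
  set S : Set ℂ := Set.range fun j : Fin (k - 1) ↦ (1 / 2 : ℂ) + (c j : ℂ) * I with hS
  have hinj : Function.Injective fun j : Fin (k - 1) ↦ (1 / 2 : ℂ) + (c j : ℂ) * I := by
    intro i j hij
    have him := congrArg Complex.im hij
    simp only [add_im, mul_im, ofReal_re, I_im, mul_one, ofReal_im, I_re, mul_zero, add_zero] at him
    have h12 : ((1 / 2 : ℂ)).im = 0 := by norm_num
    rw [h12, zero_add, zero_add] at him
    exact hcmono.injective him
  have hSncard : S.ncard = k - 1 := by
    rw [hS, Set.ncard_range_of_injective hinj, Nat.card_eq_fintype_card, Fintype.card_fin]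
  have hSsub : S ⊆ {s ∈ xiDerivZeroBox 1 T | s.re = 1 / 2} := by
    rintro s ⟨j, rfl⟩
    have him : ((1 / 2 : ℂ) + (c j : ℂ) * I).im = c j := by simp
    have hre : ((1 / 2 : ℂ) + (c j : ℂ) * I).re = 1 / 2 := by simp
    have hpos : 0 < c j := by
      have h0 : 0 < t ⟨j.1, by omega⟩ := (hmem _ (htmem _)).2.1
      linarith [hc_lo j]
    have hle : c j ≤ T := by
      have h1 : t ⟨j.1 + 1, by omega⟩ ≤ T := (hmem _ (htmem _)).2.2
      linarith [hc_hi j]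
    refine ⟨⟨?_, ?_, ?_⟩, hre⟩
    · rw [iteratedDeriv_one]
      exact hc_zero j
    · rw [him]; exact hpos
    · rw [him]; exact hle
  have hle := XiDerivCount.ncard_le_xiDerivCriticalZeroCount hSsub
  rw [hSncard] at hle
  omega

end XiDerivRolle

/-- **`N₀ˢ(T) ≤ N^{(1)}₀(T) + 1`**: the simple zeros of `ζ` on the critical line with `0 < Im ρ ≤ T`
(`simpleCriticalZeroCount`, each a distinct point of the segment) number at most one more than the
zeros of `ξ′` on the critical line up to height `T` counted with multiplicity
(`xiDerivCriticalZeroCount 1 T`) — Rolle's theorem for `Ξ` between consecutive critical zeros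
(`XiDerivRolle.ncard_criticalZeros_le`). [cite: Conrey1983, §1 (p. 49)] -/
theorem simpleCriticalZeroCount_le_xiDerivCriticalZeroCount_add_one (T : ℝ) :
    simpleCriticalZeroCount T ≤ xiDerivCriticalZeroCount 1 T + 1 := by
  have hsub : {ρ ∈ zetaZeroBox (1 / 2) T | ρ.re = 1 / 2 ∧ riemannZetaZeroOrder ρ = 1} ⊆
      {ρ ∈ zetaZeroBox (1 / 2) T | ρ.re = 1 / 2} := fun ρ hρ ↦ ⟨hρ.1, hρ.2.1⟩
  exact (Set.ncard_le_ncard hsub (criticalZeroSet_finite T)).trans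
    (XiDerivRolle.ncard_criticalZeros_le T)

/-- **Unconditionally, at least `(2/3 − ε) N(T)` zeros of `ξ′` lie on the critical line below height `T`.**
For every `ε > 0` and all sufficiently large `T`, `(2/3 − ε) N(T) ≤ N^{(1)}₀(T)`
(`N = zetaZeroCount`, zeros of `ζ` with multiplicity; `N^{(1)}₀ = xiDerivCriticalZeroCount 1`, zeros of `ξ′`
on `Re s = ½` with multiplicity): [AF26] Theorem A (i), cumulative form — a kernel theorem of the tree,
`AlpogeFurman2026_simple_critical_holds` — gives `(2/3 − ε/2) N(T) ≤ N₀ˢ(T)` eventually, Rolle gives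
`N₀ˢ(T) ≤ N^{(1)}₀(T) + 1`, and `(ε/2) N(T) ≥ 1` eventually (`N(T) → ∞`). (Print: Conrey 1983 proves the
proportion `κ′₁ ≥ 0.8137` by Levinson's method — the named fact `conrey1983_xiDeriv_one`, not used and not
proved here.) [cite: AlpogeFurman2026, Theorem A (i) (p. 1) and Remark 7.1]
[cite: Conrey1983, §1 (p. 49)] -/
theorem eventually_two_thirds_mul_zetaZeroCount_le_xiDerivCriticalZeroCount (ε : ℝ) (hε : 0 < ε) :
    ∀ᶠ T : ℝ in atTop, (2 / 3 - ε) * (zetaZeroCount T : ℝ) ≤ xiDerivCriticalZeroCount 1 T := by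
  have hAF := AlpogeFurman2026_simple_critical_holds (ε / 2) (by positivity)
  have hN : Tendsto zetaZeroCount atTop atTop := tendsto_zetaZeroCount_atTop_holds
  obtain ⟨M, hM⟩ := exists_nat_gt (2 / ε)
  have hbig : ∀ᶠ T : ℝ in atTop, M ≤ zetaZeroCount T := hN.eventually (eventually_ge_atTop M)
  filter_upwards [hAF, hbig] with T hT hMT
  have hR : (simpleCriticalZeroCount T : ℝ) ≤ (xiDerivCriticalZeroCount 1 T : ℝ) + 1 := by
    exact_mod_cast simpleCriticalZeroCount_le_xiDerivCriticalZeroCount_add_one T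
  have hMT' : (M : ℝ) ≤ zetaZeroCount T := by exact_mod_cast hMT
  have hone : 1 ≤ ε / 2 * (zetaZeroCount T : ℝ) := by
    have h2 : 2 / ε < zetaZeroCount T := hM.trans_le hMT'
    rw [div_lt_iff₀ hε] at h2
    linarith
  linarith

/-- The same with the Riemann–von Mangoldt main term: for every `ε > 0` and all large `T`,
`(2/3 − ε) · (T/2π) log T ≤ N^{(1)}₀(T)` — unconditionally at least `(2/3 − ε)(T/2π) log T` zeros of `ξ′`
(with multiplicity) lie on the critical line with ordinate in `(0, T]`
(`AlpogeFurman2026.eventually_zetaZeroCount_near_main`: `N(T) ≥ (1 − δ)(T/2π) log T` eventually).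
[cite: AlpogeFurman2026, Theorem A (i) (p. 1) and Remark 7.1] [cite: Titchmarsh1986, Thm. 9.4] -/
theorem eventually_two_thirds_mul_main_le_xiDerivCriticalZeroCount (ε : ℝ) (hε : 0 < ε) :
    ∀ᶠ T : ℝ in atTop,
      (2 / 3 - ε) * (T / (2 * Real.pi) * Real.log T) ≤ xiDerivCriticalZeroCount 1 T := by
  rcases le_or_gt (2 / 3 : ℝ) ε with hbig | hsmall
  · filter_upwards [eventually_gt_atTop (1 : ℝ)] with T hT
    have hM : 0 ≤ T / (2 * Real.pi) * Real.log T := by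
      have := Real.log_pos hT
      positivity
    have h0 : (0 : ℝ) ≤ xiDerivCriticalZeroCount 1 T := Nat.cast_nonneg _
    nlinarith
  -- `ε < 2/3`: use `(2/3 − ε/2) N ≤ N′₀` and `N ≥ (1 − δ)·main` with `δ = ε/2`
  have h1 := eventually_two_thirds_mul_zetaZeroCount_le_xiDerivCriticalZeroCount (ε / 2) (by positivity)
  have h2 := AlpogeFurman2026.eventually_zetaZeroCount_near_main (ε / 2) (by positivity)
  filter_upwards [h1, h2, eventually_gt_atTop (1 : ℝ)] with T hT hNT hT1
  have hM : 0 ≤ T / (2 * Real.pi) * Real.log T := by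
    have := Real.log_pos hT1
    positivity
  have hlow := hNT.1
  have hc : 0 ≤ 2 / 3 - ε / 2 := by linarith
  calc (2 / 3 - ε) * (T / (2 * Real.pi) * Real.log T)
      ≤ (2 / 3 - ε / 2) * ((1 - ε / 2) * (T / (2 * Real.pi) * Real.log T)) := by
        nlinarith [mul_nonneg hε.le hM, mul_nonneg (mul_nonneg hε.le hε.le) hM]
    _ ≤ (2 / 3 - ε / 2) * (zetaZeroCount T : ℝ) := mul_le_mul_of_nonneg_left hlow hc
    _ ≤ xiDerivCriticalZeroCount 1 T := hT

end Literature.NumberTheory.LFunctions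

end
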